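import Summits.FinalStateConjecture.FinalStateConjecture.Theses.PhotonSphereChannels
import Summits.FinalStateConjecture.FinalStateConjecture.Theorems.PhotonSphereChannelsWindowedShellChannelsOfZonePoly

/-!
# Crux `WindowedShellChannels` (stmt-FinalStateConjecture-14085) — line `finite-size`
# (crux-strategist s3: the Coulomb-phase line with its analytic stub CUT BY A FINITE-SIZE CRITERION)

ALTERNATIVE line (published with `ledger crux write`, NOT activated with `ledger skeleton check`: the live skeleton
`Lines/parity_kernels.lean` of the lead is untouched).  It refines line `coulomb-phase` (strategist s2): the pure
harmonic-analysis stub F3′ (= route child-to-be `CoulombPhaseChannelLemma`, glue `windowedShellChannels_of_coulombPhase`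
landed p166112) is obtained from

* `stub_finiteSizeCriterion` — HALF-LINE CONCENTRATION IS DECIDED AT FINITE LOG-WIDTH (phase-blind, parity-blind, Mathlib-only,
  PROVABLE NOW): for `c₀ ∈ (0,1]` and the explicit width `Λ(c₀) = 10⁷(1+|log c₀|)/c₀²`, if every log-block `c·𝟙_[Ω,Ωe^L]`,
  `L ≤ Λ(c₀)`, of a bounded measurable compactly supported density `c` on `(0,∞)` satisfies `c₀·E(block) ≤ A − |B|` (block),
  then `(c₀/2)·E(c) ≤ A − |B|` (c).  Proof: `A ∓ B = 2∫_{u≤u₀}(Im/Re Z)²` are `‖T·‖²` of a real `L²` function with `T` the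
  projection onto `{u ≤ u₀}`; induction on the log-width (`L ↦ 4L/3`), a pigeonholed light buffer of width `w_n = w₀ + n`
  in the middle third, Cauchy–Schwarz, and LOG-LOCALITY of `T` across log-separated frequency bands (off-diagonal kernel
  `1/(ω ∓ ω′)` = `1/(2 sinh|cosh((s−s′)/2))` in `s = log ω`, operator norm `≤ 1.4 e^{−w/2}` across a log-gap `w`); losses
  summable.  The integer inverse-square model (block constant `≍ 1/L`) shows `Λ` must grow at least like `1/c₀`.
* `stub_coulombSeed` — F3′ AT FINITE LOG-WIDTH (the seed): the Coulomb-phase hypotheses on `θ` (two-sided pinned log-curvature,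
  delays before the cut, benign limit) give `c₀(a,A)·E ≤ A − |B|` for densities living in ONE log-block of width `≤ Λ(c₀)`.
  Finitely many e-folds: compact in the block position `Ωa` up to the two explicit limits `Ωa → 0` (benign-affine phase:
  the DKM identity, landed anchor `Literature.Analysis.Fourier.benignConstantPhase_identity` p163262) and `Ωa → ∞`
  (monotone chirp, stationary phase) — a perturbation/compactness statement instead of an infinite-scale one.
* `stub_spectralReduction` — verbatim the s2 stub (= route child-to-be `WindowedShellKernelOfCoulombPhase`): F3′ ⇒ the
  landed kernel for every real parity `σ` (RW spectral package F1 + F2 + top band + coupling; the named vocabulary debt).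

`coulombPhaseLemma_of_seed` (PROVED below): criterion + seed ⇒ F3′ verbatim (a continuous compactly supported density is
an admissible one; constant `c₀/2`).  `WindowedShellChannels_of` = `windowedShellChannels_of_zonePoly (stub_spectralReduction
(coulombPhaseLemma_of_seed stub_finiteSizeCriterion stub_coulombSeed))`.  Sorries ONLY in `stub_*`.
-/

noncomputable section

set_option linter.dupNamespace false

namespace Summit.FinalStateConjecture.FinalStateConjecture.Cruxes.WindowedShellChannels.FiniteSize

open Literature.Geometry.Lorentzian Literature.Geometry.Lorentzian.ReggeWheeler
open Summit.FinalStateConjecture.FinalStateConjecture.Theses.PhotonSphereChannels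
open Summit.FinalStateConjecture.FinalStateConjecture.Theorems.WindowedShellChannelsSketch
open Filter Set MeasureTheory
open scoped ENNReal Topology

/-- STUB 1 — THE FINITE-SIZE CRITERION (abstract `L²(ℝ)` harmonic analysis; provable now; size M–L).  In the `A − |B|`
form of the Coulomb-phase lemma, with the explicit width `Λ(c₀) = 10⁷(1+|log c₀|)/c₀²`. -/
theorem stub_finiteSizeCriterion : ∀ c₀ : ℝ, 0 < c₀ → c₀ ≤ 1 → ∀ (θ : ℝ → ℝ) (u₀ : ℝ) (c : ℝ → ℝ), Measurable c → (∃ B : ℝ, ∀ ω, |c ω| ≤ B) → HasCompactSupport c → Function.support c ⊆ Set.Ioi 0 → (∀ Ω L : ℝ, 0 < Ω → 0 < L → L ≤ 10 ^ 7 * (1 + |Real.log c₀|) / c₀ ^ 2 → let cJ : ℝ → ℝ := (Set.Icc Ω (Ω * Real.exp L)).indicator c; let ZJ : ℝ → ℂ := fun u => ∫ ω, (cJ ω : ℂ) * Complex.exp (Complex.I * ((θ ω : ℂ) - (ω : ℂ) * (u : ℂ))); c₀ * (2 * Real.pi * ∫ ω, cJ ω ^ 2) ≤ (∫ u in Set.Iic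 u₀, ‖ZJ u‖ ^ 2) - |(∫ u in Set.Iic u₀, ZJ u ^ 2).re|) → let Z : ℝ → ℂ := fun u => ∫ ω, (c ω : ℂ) * Complex.exp (Complex.I * ((θ ω : ℂ) - (ω : ℂ) * (u : ℂ))); c₀ / 2 * (2 * Real.pi * ∫ ω, c ω ^ 2) ≤ (∫ u in Set.Iic u₀, ‖Z u‖ ^ 2) - |(∫ u in Set.Iic u₀, Z u ^ 2).re| := by
  sorry

/-- STUB 2 — THE COULOMB-PHASE LEMMA AT FINITE LOG-WIDTH (the seed; size L–XL; the analytic heart of the line, now over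
finitely many e-folds).  Densities: measurable, bounded, compactly supported in `(0, W)`; blocks of width `≤ Λ(c₀)`. -/
theorem stub_coulombSeed : ∀ a A : ℝ, 0 < a → a ≤ A → ∃ c₀ : ℝ, 0 < c₀ ∧ c₀ ≤ 1 ∧ ∀ (W u₀ : ℝ), 0 < W → ∀ (θ θ' θ'' : ℝ → ℝ), (∀ ω ∈ Set.Ioo 0 W, HasDerivAt θ (θ' ω) ω ∧ HasDerivAt θ' (θ'' ω) ω) → (∀ ω ∈ Set.Ioo 0 W, a / ω ≤ θ'' ω ∧ θ'' ω ≤ A / ω) → (∀ ω ∈ Set.Ioo 0 W, θ' ω ≤ u₀) → (∃ m : ℤ, Tendsto θ (𝓝[>] 0) (𝓝 (m * Real.pi / 2))) → ∀ c : ℝ → ℝ, Measurable c → (∃ B : ℝ, ∀ ω, |c ω| ≤ B) → HasCompactSupport c → Function.support c ⊆ Set.Ioi 0 → Function.support c ⊆ Set.Ioo 0 W → ∀ Ω L : ℝ, 0 < Ω → 0 < L → L ≤ 10 ^ 7 * (1 + |Real.log c₀|) / c₀ ^ 2 → let cJ : ℝ → ℝ := (Set.Icc Ω (Ω * Real.exp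 L)).indicator c; let ZJ : ℝ → ℂ := fun u => ∫ ω, (cJ ω : ℂ) * Complex.exp (Complex.I * ((θ ω : ℂ) - (ω : ℂ) * (u : ℂ))); c₀ * (2 * Real.pi * ∫ ω, cJ ω ^ 2) ≤ (∫ u in Set.Iic u₀, ‖ZJ u‖ ^ 2) - |(∫ u in Set.Iic u₀, ZJ u ^ 2).re| := by
  sorry

/-- STUB 3 — THE REGGE–WHEELER SPECTRAL REDUCTION (verbatim `stub_spectralReduction` of line `coulomb-phase`; = route
child-to-be `WindowedShellKernelOfCoulombPhase`): F3′ ⇒ the polynomial-zone kernel for every real time parity `σ`. -/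
theorem stub_spectralReduction : (∀ a A : ℝ, 0 < a → a ≤ A → ∃ c₀ : ℝ, 0 < c₀ ∧ ∀ (W u₀ : ℝ), 0 < W → ∀ (θ θ' θ'' : ℝ → ℝ), (∀ ω ∈ Set.Ioo 0 W, HasDerivAt θ (θ' ω) ω ∧ HasDerivAt θ' (θ'' ω) ω) → (∀ ω ∈ Set.Ioo 0 W, a / ω ≤ θ'' ω ∧ θ'' ω ≤ A / ω) → (∀ ω ∈ Set.Ioo 0 W, θ' ω ≤ u₀) → (∃ m : ℤ, Tendsto θ (𝓝[>] 0) (𝓝 (m * Real.pi / 2))) → ∀ c : ℝ → ℝ, Continuous c → HasCompactSupport c → Function.support c ⊆ Set.Ioo 0 W → let Z : ℝ → ℂ := fun u => ∫ ω, (c ω : ℂ) * Complex.exp (Complex.I * ((θ ω : ℂ) - (ω : ℂ) * (u : ℂ))); c₀ * (2 * Real.pi * ∫ ω, c ω ^ 2) ≤ (∫ u in Set.Iic u₀, ‖Z u‖ ^ 2) - |(∫ u in Set.Iic u₀, Z u ^ 2).re|) → ∀ σ : ℝ, ∀ ρ : ℝ, 0 < ρ → ∃ h : ℝ, 0 ≤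 h ∧ ∃ c : ℝ, 0 < c ∧ ∀ k : ℕ, ∃ ℓ₀ : ℕ, ∀ (s ℓ : ℕ), s ≤ 2 → s ≤ ℓ → ℓ₀ ≤ ℓ → ∀ ψ : ℝ → ℝ → ℝ, IsRWSolution 1 s ℓ (tortoiseRadius one_pos 0) ψ → (∀ t x, ψ (-t) x = σ * ψ t x) → CauchyDataSupportedOn ψ ({x : ℝ | ρ < |x|} ∩ Icc (-(((ℓ : ℝ) + 2) ^ k)) (((ℓ : ℝ) + 2) ^ k)) → totalEnergy (linePotential 1 s ℓ (tortoiseRadius one_pos 0)) ψ 0 ≠ ⊤ → ENNReal.ofReal c * totalEnergy (linePotential 1 s ℓ (tortoiseRadius one_pos 0)) ψ 0 ≤ channelEnergy (linePotential 1 s ℓ (tortoiseRadius one_pos 0)) 0 (ρ - h) ψ atTop := by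
  sorry

/-! ## Glue (proved) -/

/-- **Criterion + seed ⇒ the Coulomb-phase channel lemma** (F3′ verbatim, constant halved): a continuous compactly supported
density with support in `(0, W)` is measurable, bounded and supported in `(0, ∞)`, so the seed applies to all its blocks
of width `≤ Λ(c₀)` and the criterion concludes. [new] -/
theorem coulombPhaseLemma_of_seed (hcrit : ∀ c₀ : ℝ, 0 < c₀ → c₀ ≤ 1 → ∀ (θ : ℝ → ℝ) (u₀ : ℝ) (c : ℝ → ℝ), Measurable c → (∃ B : ℝ, ∀ ω, |c ω| ≤ B) → HasCompactSupport c → Function.support c ⊆ Set.Ioi 0 → (∀ Ω L : ℝ, 0 < Ω → 0 < L → L ≤ 10 ^ 7 * (1 + |Real.log c₀|) / c₀ ^ 2 → let cJ : ℝ → ℝ := (Set.Icc Ω (Ω * Real.exp L)).indicator c; let ZJ : ℝ → ℂ := fun u => ∫ ω, (cJ ω : ℂ) * Complex.exp (Complex.I * ((θ ω : ℂ) - (ω : ℂ) * (u : ℂ))); c₀ * (2 * Real.pi * ∫ ω, cJ ω ^ 2) ≤ (∫ u in Set.Iic u₀, ‖ZJ u‖ ^ 2) - |(∫ u in Set.Iic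 u₀, ZJ u ^ 2).re|) → let Z : ℝ → ℂ := fun u => ∫ ω, (c ω : ℂ) * Complex.exp (Complex.I * ((θ ω : ℂ) - (ω : ℂ) * (u : ℂ))); c₀ / 2 * (2 * Real.pi * ∫ ω, c ω ^ 2) ≤ (∫ u in Set.Iic u₀, ‖Z u‖ ^ 2) - |(∫ u in Set.Iic u₀, Z u ^ 2).re|) (hseed : ∀ a A : ℝ, 0 < a → a ≤ A → ∃ c₀ : ℝ, 0 < c₀ ∧ c₀ ≤ 1 ∧ ∀ (W u₀ : ℝ), 0 < W → ∀ (θ θ' θ'' : ℝ → ℝ), (∀ ω ∈ Set.Ioo 0 W, HasDerivAt θ (θ' ω) ω ∧ HasDerivAt θ' (θ'' ω) ω) → (∀ ω ∈ Set.Ioo 0 W, a / ω ≤ θ'' ω ∧ θ'' ω ≤ A / ω) → (∀ ω ∈ Set.Ioo 0 W, θ' ω ≤ u₀) → (∃ m : ℤ, Tendsto θ (𝓝[>] 0) (𝓝 (m * Real.pi / 2))) → ∀ c : ℝ → ℝ, Measurable c → (∃ B : ℝ, ∀ ω, |c ω| ≤ B) → HasCompactSupport c → Function.support c ⊆ Set.Ioi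 0 → Function.support c ⊆ Set.Ioo 0 W → ∀ Ω L : ℝ, 0 < Ω → 0 < L → L ≤ 10 ^ 7 * (1 + |Real.log c₀|) / c₀ ^ 2 → let cJ : ℝ → ℝ := (Set.Icc Ω (Ω * Real.exp L)).indicator c; let ZJ : ℝ → ℂ := fun u => ∫ ω, (cJ ω : ℂ) * Complex.exp (Complex.I * ((θ ω : ℂ) - (ω : ℂ) * (u : ℂ))); c₀ * (2 * Real.pi * ∫ ω, cJ ω ^ 2) ≤ (∫ u in Set.Iic u₀, ‖ZJ u‖ ^ 2) - |(∫ u in Set.Iic u₀, ZJ u ^ 2).re|) : ∀ a A : ℝ, 0 < a → a ≤ A → ∃ c₀ : ℝ, 0 < c₀ ∧ ∀ (W u₀ : ℝ), 0 < W → ∀ (θ θ' θ'' : ℝ → ℝ), (∀ ω ∈ Set.Ioo 0 W, HasDerivAt θ (θ' ω) ω ∧ HasDerivAt θ' (θ'' ω) ω) → (∀ ω ∈ Set.Ioo 0 W, a / ω ≤ θ'' ω ∧ θ'' ω ≤ A / ω) → (∀ ω ∈ Set.Ioo 0 W, θ' ω ≤ u₀) → (∃ m : ℤ, Tendsto θ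 (𝓝[>] 0) (𝓝 (m * Real.pi / 2))) → ∀ c : ℝ → ℝ, Continuous c → HasCompactSupport c → Function.support c ⊆ Set.Ioo 0 W → let Z : ℝ → ℂ := fun u => ∫ ω, (c ω : ℂ) * Complex.exp (Complex.I * ((θ ω : ℂ) - (ω : ℂ) * (u : ℂ))); c₀ * (2 * Real.pi * ∫ ω, c ω ^ 2) ≤ (∫ u in Set.Iic u₀, ‖Z u‖ ^ 2) - |(∫ u in Set.Iic u₀, Z u ^ 2).re| := by
  intro a A ha hA
  obtain ⟨c₀, hc0, hc1, H⟩ := hseed a A ha hA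
  refine ⟨c₀ / 2, by positivity, fun W u₀ hW θ θ' θ'' hder hcurv hdel hben c hc hcs hcW => ?_⟩
  have hmeas : Measurable c := hc.measurable
  have hbdd : ∃ B : ℝ, ∀ ω, |c ω| ≤ B := by
    obtain ⟨B, hB⟩ := hc.bounded_above_of_compact_support hcs
    exact ⟨B, fun ω => by simpa [Real.norm_eq_abs] using hB ω⟩
  have hpos : Function.support c ⊆ Set.Ioi 0 := fun ω hω => (hcW hω).1
  exact hcrit c₀ hc0 hc1 θ u₀ c hmeas hbdd hcs hpos
    (fun Ω L hΩ hL hLw => H W u₀ hW θ θ' θ'' hder hcurv hdel hben c hmeas hbdd hcs hpos hcW Ω L hΩ hL hLw)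

/-- **Line `finite-size` closes the crux modulo its three stubs** (kernel reduction `windowedShellChannels_of_zonePoly`,
landed p135139). -/
theorem WindowedShellChannels_of : WindowedShellChannels :=
  windowedShellChannels_of_zonePoly
    (stub_spectralReduction (coulombPhaseLemma_of_seed stub_finiteSizeCriterion stub_coulombSeed))

end Summit.FinalStateConjecture.FinalStateConjecture.Cruxes.WindowedShellChannels.FiniteSize

end
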